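/-
Copyright: the b2b-balaban T⁴-continuum CRUX team, row NE7b OWNER lineage `t4-ne7b-p1` (gen 141). Project licence.
-/
import Summits.QuantumFields.BalabanUV.T4Continuum.Spine.NE7b.SupDobrushinCovarianceGibbs
import Summits.QuantumFields.BalabanUV.T4Continuum.Spine.NE7b.SupThirdCumulantTreeDecay

/-!
# THE THREE FIXED-SLOT LETTERS OF THE OUTPUT'S THIRD-ORDER ENTRY MAJORANT (SCOPING (d13)(1), fourth file; finite sums).  (479)'s
# background-free majorant of `D³W` has the shape
#   `M_{xyz} = K3_{yzx} + E(g_{xz}, b_y) + E(g_{xy}, b_z) + E(b_x, g_{yz}) + C_T∕(ρ_{xy}ρ_{xz})`,   `E(a,b) = Σ_w (Dᵀa)_w(Dᵀb)_w∕c`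
# (`g_{xy}` the Hessian-entry observables' vectors, `b_v` the gradient components' vectors, `D ≥ 0` with plain row∕column letters `dr, dc`).
# FORMAT AUDIT: the input letter `|U‴φ[e_u,e_x,e_y]| ≤ K3_{xyu}` indexes `K3` by `T`'s slots `(2,3,1)`, so to ITERATE one needs the output
# majorant's double sums with EACH slot fixed — slot 1 (`Σ_{y,z}`, the row letter of (475)'s kind), slot 2 (`Σ_{x,z}`) and slot 3 (`Σ_{x,y}`);
# they close on THREE input letters of `K3` (`k3c`: slot 1 of `U‴` fixed = `Σ_{y,z}K3_{yzu}`; `k3r`: `Σ_{y,u}K3_{xyu}`; `k3m`: `Σ_{x,u}K3_{xyu}`),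
# the masses of `g` (`gr`: first index fixed; `gm`: second index fixed; `gc`: column over both), the row∕column letters `br, bc` of `b`,
# and the site letter `Σ_yρ_{xy}⁻¹ ≤ S` (all `x`):
#   slot 1: `Σ_{y,z} M_{xyz} ≤ k3c + (2·gr·bc + br·gc)·dr·dc∕c + C_T·S²`
#   slot 2: `Σ_{x,z} M_{xyz} ≤ k3r + (br·gc + gm·bc + gr·bc)·dr·dc∕c + C_T·S²`
#   slot 3: `Σ_{x,y} M_{xyz} ≤ k3m + (2·gm·bc + br·gc)·dr·dc∕c + C_T·S²`
# — NO symmetry of `T` or of `K3` is used (for a symmetric third derivative one may take `k3r = k3c = k3m`, `gr = gm`) (row NE7b, node U5c;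
# (447) `bilinear_rowsum_le`, (463) `tree_double_sum_le` BY NAME; [folklore] finite sums)

Cell `pub-balaban`, sub-cell `t4`, spine estimate NE7b (`T4WeightBudget.RelWeightBound`; the cell's OWN estimate — NOT PRINTED in
[Bałaban 1983–89], NOT PROVED).  Crux-route work under `Spine/NE7b/` by the row OWNER (`t4-ne7b-p1` gen 141, file (480)) under FREEZE
(0)'s crux-prover clause; NOTHING of Bałaban's is named as a Lean object, valued or asserted; no `T4Continuum/Support` leaf typed; no
`def`, no notation (`M` and `E` WRITTEN OUT); zero `sorry`.  Imports (BY NAME): the OWNER's (447) `…SupDobrushinCovarianceGibbs`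
(`bilinear_rowsum_le`), (463) `…SupThirdCumulantTreeDecay` (`tree_double_sum_le`).

WHAT IS PROVED ([folklore]; `g : ι → ι → κ → ℝ`, `b : ι → κ → ℝ`, `D : κ → κ → ℝ` nonnegative, `c > 0`, `ρ ≥ 1` symmetric):
* §1 `two_point_symm` (`E(a,b) = E(b,a)`), `two_point_family_sum_le` ((447) over `univ`, constant `c`), `two_point_pair_sum_le` (families over
  pairs), `tree_sum_slot_two`, `tree_sum_slot_three` (`Σ_xρ_{xy}⁻¹Σ_zρ_{xz}⁻¹ ≤ S²`).
* §2 THE ENDS **`entry_majorant_slot_one`**, **`entry_majorant_slot_two`**, **`entry_majorant_slot_three`**; §3 toy.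

HONEST (what this is NOT).  Bookkeeping of finite sums; the instantiation `g_{xyw} = Σ_u|A_{uw}|K3_{xyu}`, `b_{vw} = Σ_u|A_{uw}|Hk_{vu}`,
`c = 1 − lamA`, `D` = the (weighted) Neumann series with (448)∕(453)∕(462)'s letters, and the packaging with (459) (order 2) into the class map
are the next files; scalar skeleton ((A3), NC-NE7b-α UNRULED); nothing of Bałaban's asserted.  BY-NAME EFFECT ON THE WALL: NONE.  NE7b NOT
PRINTED ∕ NOT PROVED; spine PROVED 0∕9; rung (B)+1 — the programme's measures remain FINITE-torus statements; NOT the mass gap, NOT Clay.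
HONEST DEPENDENCY: continuum YM on T⁴ ⇐ BetaPertH ∧ nine spine estimates (0∕9 proved); BetaPertH ⇐ (D1) ∧ (D4) ∧ CAP+tail; G-an2-4
gates asym, D1 and NE2∕3∕4.
-/

set_option autoImplicit false

noncomputable section

namespace Summit.QuantumFields.BalabanUV.T4Continuum.NE7b.SupThirdKernelEntryLetters

open Real Finset
open scoped BigOperators
open SupDobrushinCovarianceGibbs (bilinear_rowsum_le)
open SupThirdCumulantTreeDecay (tree_double_sum_le)

variable {ι κ : Type} [Fintype ι] [Fintype κ]

variable {g : ι → ι → κ → ℝ} {b : ι → κ → ℝ} {D : κ → κ → ℝ} {K3 : ι → ι → ι → ℝ} {ρ : ι → ι → ℝ}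
  {c dr dc gr gm gc br bc k3r k3c k3m S CT : ℝ}

/-! ## §1. The two-point and tree pieces, summed -/

omit [Fintype ι] in
/-- `E(a,b) = E(b,a)`. [folklore] -/
theorem two_point_symm (a a' : κ → ℝ) (D : κ → κ → ℝ) (c : ℝ) :
    ∑ w, (∑ z', D z' w * a z') * (∑ z', D z' w * a' z') / c = ∑ w, (∑ z', D z' w * a' z') * (∑ z', D z' w * a z') / c :=
  Finset.sum_congr rfl fun w _ => by ring

/-- **(447) over `univ` with a constant `c`**: `Σ_y E(a, bf_y) ≤ (Σa)·κc·dr·dc∕c` for a family `bf` with column letter `Σ_y bf_{yz} ≤ κc`.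
[folklore] -/
theorem two_point_family_sum_le {β : Type} [Fintype β] {a : κ → ℝ} {bf : β → κ → ℝ} {κc : ℝ} (hD : ∀ x y, 0 ≤ D x y)
    (hDr : ∀ z, ∑ w, D z w ≤ dr) (hDc : ∀ w, ∑ z, D z w ≤ dc) (hc : 0 < c) (ha : ∀ z, 0 ≤ a z) (hb : ∀ y z, 0 ≤ bf y z)
    (hbc : ∀ z, ∑ y, bf y z ≤ κc) :
    ∑ y, ∑ w, (∑ z', D z' w * a z') * (∑ z', D z' w * bf y z') / c ≤ (∑ z, a z) * κc * dr * dc / c :=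
  bilinear_rowsum_le (c := fun _ => c) Finset.univ hD hDr hDc hc (fun _ => le_rfl) ha hb (fun z => hbc z)

/-- **Families over pairs**: `Σ_y Σ_z E(a, g_{yz}) ≤ (Σa)·gc·dr·dc∕c` for the column letter `Σ_{y,z} g_{yzw} ≤ gc`. [folklore] -/
theorem two_point_pair_sum_le {a : κ → ℝ} (hD : ∀ x y, 0 ≤ D x y) (hDr : ∀ z, ∑ w, D z w ≤ dr) (hDc : ∀ w, ∑ z, D z w ≤ dc) (hc : 0 < c)
    (ha : ∀ z, 0 ≤ a z) (hg0 : ∀ x y w, 0 ≤ g x y w) (hgc : ∀ w, ∑ y, ∑ z, g y z w ≤ gc) :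
    ∑ y, ∑ z, ∑ w, (∑ z', D z' w * a z') * (∑ z', D z' w * g y z z') / c ≤ (∑ z, a z) * gc * dr * dc / c := by
  have h := two_point_family_sum_le (bf := fun p : ι × ι => g p.1 p.2) (κc := gc) hD hDr hDc hc ha (fun p z => hg0 p.1 p.2 z)
    (fun z => by rw [Fintype.sum_prod_type]; exact hgc z)
  rw [Fintype.sum_prod_type] at h
  exact h

/-- **The tree piece, slot 2**: `Σ_x Σ_z C_T∕(ρ_{xy}ρ_{xz}) ≤ C_T·S²` (`ρ` symmetric, `Σ_yρ_{xy}⁻¹ ≤ S` for all `x`). [folklore] -/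
theorem tree_sum_slot_two (hCT : 0 ≤ CT) (hρ1 : ∀ x y, 1 ≤ ρ x y) (hρsymm : ∀ x y, ρ x y = ρ y x) (hS : ∀ x, ∑ y, 1 / ρ x y ≤ S) (y : ι) :
    ∑ x, ∑ z, CT / (ρ x y * ρ x z) ≤ CT * S ^ 2 := by
  have hρ0 : ∀ x y, 0 < ρ x y := fun x y => lt_of_lt_of_le one_pos (hρ1 x y)
  have hS0 : 0 ≤ S := le_trans (Finset.sum_nonneg fun z _ => div_nonneg zero_le_one (hρ0 y z).le) (hS y)
  have e : ∀ x, ∑ z, CT / (ρ x y * ρ x z) = CT * (1 / ρ x y) * ∑ z, 1 / ρ x z := fun x => by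
    rw [Finset.mul_sum]
    exact Finset.sum_congr rfl fun z _ => by
      have h1 := (hρ0 x y).ne'
      have h2 := (hρ0 x z).ne'
      field_simp
  simp_rw [e]
  calc ∑ x, CT * (1 / ρ x y) * ∑ z, 1 / ρ x z ≤ ∑ x, CT * (1 / ρ x y) * S :=
        Finset.sum_le_sum fun x _ => mul_le_mul_of_nonneg_left (hS x) (mul_nonneg hCT (div_nonneg zero_le_one (hρ0 x y).le))
    _ = CT * S * ∑ x, 1 / ρ y x := by
        rw [Finset.mul_sum]
        exact Finset.sum_congr rfl fun x _ => by rw [hρsymm x y]; ring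
    _ ≤ CT * S * S := mul_le_mul_of_nonneg_left (hS y) (mul_nonneg hCT hS0)
    _ = CT * S ^ 2 := by ring

/-- **The tree piece, slot 3**: `Σ_x Σ_y C_T∕(ρ_{xy}ρ_{xz}) ≤ C_T·S²`. [folklore] -/
theorem tree_sum_slot_three (hCT : 0 ≤ CT) (hρ1 : ∀ x y, 1 ≤ ρ x y) (hρsymm : ∀ x y, ρ x y = ρ y x) (hS : ∀ x, ∑ y, 1 / ρ x y ≤ S) (z : ι) :
    ∑ x, ∑ y, CT / (ρ x y * ρ x z) ≤ CT * S ^ 2 := by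
  have e : ∀ x, ∑ y, CT / (ρ x y * ρ x z) = ∑ y, CT / (ρ x z * ρ x y) := fun x => Finset.sum_congr rfl fun y _ => by rw [mul_comm]
  simp_rw [e]
  exact tree_sum_slot_two hCT hρ1 hρsymm hS z

/-! ## §2. THE ENDS: the three fixed-slot double sums of `M` -/

/-- **SLOT 1 (the row letter; `x` fixed)**: `Σ_y Σ_z M_{xyz} ≤ k3c + (2·gr·bc + br·gc)·dr·dc∕c + C_T·S²`. [folklore] -/
theorem entry_majorant_slot_one [Nonempty κ] (hD : ∀ x y, 0 ≤ D x y) (hDr : ∀ z, ∑ w, D z w ≤ dr) (hDc : ∀ w, ∑ z, D z w ≤ dc) (hc : 0 < c)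
    (hg0 : ∀ x y w, 0 ≤ g x y w) (hb0 : ∀ v w, 0 ≤ b v w) (hgr : ∀ x, ∑ z, ∑ w, g x z w ≤ gr) (hgc : ∀ w, ∑ y, ∑ z, g y z w ≤ gc)
    (hbr : ∀ v, ∑ w, b v w ≤ br) (hbc : ∀ w, ∑ v, b v w ≤ bc) (hk3c : ∀ u, ∑ y, ∑ z, K3 y z u ≤ k3c)
    (hCT : 0 ≤ CT) (hρ1 : ∀ x y, 1 ≤ ρ x y) (hS : ∀ x, ∑ y, 1 / ρ x y ≤ S) (x : ι) :
    ∑ y, ∑ z, (K3 y z x + ∑ w, (∑ z', D z' w * g x z z') * (∑ z', D z' w * b y z') / c + ∑ w, (∑ z', D z' w * g x y z') * (∑ z', D z' w * b z z') / c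
        +
        ∑ w, (∑ z', D z' w * b x z') * (∑ z', D z' w * g y z z') / c + CT / (ρ x y * ρ x z)) ≤
      k3c + (2 * (gr * bc) + br * gc) * dr * dc / c + CT * S ^ 2 := by
  obtain ⟨w₀⟩ := ‹Nonempty κ›
  have hbc0 : 0 ≤ bc := le_trans (Finset.sum_nonneg fun v _ => hb0 v w₀) (hbc w₀)
  have hgc0 : 0 ≤ gc := le_trans (Finset.sum_nonneg fun y _ => Finset.sum_nonneg fun z _ => hg0 y z w₀) (hgc w₀)
  have hdr0 : 0 ≤ dr := le_trans (Finset.sum_nonneg fun w _ => hD w₀ w) (hDr w₀)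
  have hdc0 : 0 ≤ dc := le_trans (Finset.sum_nonneg fun z _ => hD z w₀) (hDc w₀)
  have hK : 0 ≤ bc * dr * dc / c := by positivity
  have hK' : 0 ≤ gc * dr * dc / c := by positivity
  simp only [Finset.sum_add_distrib]
  -- (a) the average piece
  have ha : ∑ y, ∑ z, K3 y z x ≤ k3c := hk3c x
  -- (b) `Σ_y Σ_z E(g_{xz}, b_y) = Σ_z Σ_y E(g_{xz}, b_y)`
  have hb : ∑ y, ∑ z, ∑ w, (∑ z', D z' w * g x z z') * (∑ z', D z' w * b y z') / c ≤ gr * (bc * dr * dc / c) := by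
    rw [Finset.sum_comm]
    calc ∑ z, ∑ y, ∑ w, (∑ z', D z' w * g x z z') * (∑ z', D z' w * b y z') / c ≤ ∑ z, (∑ z', g x z z') * bc * dr * dc / c :=
          Finset.sum_le_sum fun z _ => two_point_family_sum_le hD hDr hDc hc (fun z' => hg0 x z z') hb0 hbc
      _ = (∑ z, ∑ z', g x z z') * (bc * dr * dc / c) := by rw [Finset.sum_mul]; exact Finset.sum_congr rfl fun z _ => by ring
      _ ≤ gr * (bc * dr * dc / c) := mul_le_mul_of_nonneg_right (hgr x) hK
  -- (c) `Σ_y Σ_z E(g_{xy}, b_z)`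
  have hc' : ∑ y, ∑ z, ∑ w, (∑ z', D z' w * g x y z') * (∑ z', D z' w * b z z') / c ≤ gr * (bc * dr * dc / c) := by
    calc ∑ y, ∑ z, ∑ w, (∑ z', D z' w * g x y z') * (∑ z', D z' w * b z z') / c ≤ ∑ y, (∑ z', g x y z') * bc * dr * dc / c :=
          Finset.sum_le_sum fun y _ => two_point_family_sum_le hD hDr hDc hc (fun z' => hg0 x y z') hb0 hbc
      _ = (∑ y, ∑ z', g x y z') * (bc * dr * dc / c) := by rw [Finset.sum_mul]; exact Finset.sum_congr rfl fun y _ => by ring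
      _ ≤ gr * (bc * dr * dc / c) := mul_le_mul_of_nonneg_right (hgr x) hK
  -- (d) `Σ_y Σ_z E(b_x, g_{yz})`
  have hd : ∑ y, ∑ z, ∑ w, (∑ z', D z' w * b x z') * (∑ z', D z' w * g y z z') / c ≤ br * (gc * dr * dc / c) := by
    calc ∑ y, ∑ z, ∑ w, (∑ z', D z' w * b x z') * (∑ z', D z' w * g y z z') / c ≤ (∑ z', b x z') * gc * dr * dc / c :=
          two_point_pair_sum_le hD hDr hDc hc (fun z' => hb0 x z') hg0 hgc
      _ = (∑ z', b x z') * (gc * dr * dc / c) := by ring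
      _ ≤ br * (gc * dr * dc / c) := mul_le_mul_of_nonneg_right (hbr x) hK'
  -- (e) the tree piece
  have he : ∑ y, ∑ z, CT / (ρ x y * ρ x z) ≤ CT * S ^ 2 := tree_double_sum_le hCT hρ1 x (hS x)
  have etot : k3c + (2 * (gr * bc) + br * gc) * dr * dc / c + CT * S ^ 2 =
      k3c + gr * (bc * dr * dc / c) + gr * (bc * dr * dc / c) + br * (gc * dr * dc / c) + CT * S ^ 2 := by ring
  rw [etot]
  linarith

/-- **SLOT 2 (`y` fixed)**: `Σ_x Σ_z M_{xyz} ≤ k3r + (br·gc + gm·bc + gr·bc)·dr·dc∕c + C_T·S²`. [folklore] -/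
theorem entry_majorant_slot_two [Nonempty κ] (hD : ∀ x y, 0 ≤ D x y) (hDr : ∀ z, ∑ w, D z w ≤ dr) (hDc : ∀ w, ∑ z, D z w ≤ dc) (hc : 0 < c)
    (hg0 : ∀ x y w, 0 ≤ g x y w) (hb0 : ∀ v w, 0 ≤ b v w) (hgr : ∀ x, ∑ z, ∑ w, g x z w ≤ gr) (hgm : ∀ y, ∑ x, ∑ w, g x y w ≤ gm)
    (hgc : ∀ w, ∑ y, ∑ z, g y z w ≤ gc) (hbr : ∀ v, ∑ w, b v w ≤ br) (hbc : ∀ w, ∑ v, b v w ≤ bc) (hk3r : ∀ x, ∑ y, ∑ u, K3 x y u ≤ k3r)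
    (hCT : 0 ≤ CT) (hρ1 : ∀ x y, 1 ≤ ρ x y) (hρsymm : ∀ x y, ρ x y = ρ y x) (hS : ∀ x, ∑ y, 1 / ρ x y ≤ S) (y : ι) :
    ∑ x, ∑ z, (K3 y z x + ∑ w, (∑ z', D z' w * g x z z') * (∑ z', D z' w * b y z') / c + ∑ w, (∑ z', D z' w * g x y z') * (∑ z', D z' w * b z z') / c
        +
        ∑ w, (∑ z', D z' w * b x z') * (∑ z', D z' w * g y z z') / c + CT / (ρ x y * ρ x z)) ≤
      k3r + (br * gc + gm * bc + gr * bc) * dr * dc / c + CT * S ^ 2 := by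
  obtain ⟨w₀⟩ := ‹Nonempty κ›
  have hbc0 : 0 ≤ bc := le_trans (Finset.sum_nonneg fun v _ => hb0 v w₀) (hbc w₀)
  have hgc0 : 0 ≤ gc := le_trans (Finset.sum_nonneg fun y _ => Finset.sum_nonneg fun z _ => hg0 y z w₀) (hgc w₀)
  have hdr0 : 0 ≤ dr := le_trans (Finset.sum_nonneg fun w _ => hD w₀ w) (hDr w₀)
  have hdc0 : 0 ≤ dc := le_trans (Finset.sum_nonneg fun z _ => hD z w₀) (hDc w₀)
  have hK : 0 ≤ bc * dr * dc / c := by positivity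
  have hK' : 0 ≤ gc * dr * dc / c := by positivity
  simp only [Finset.sum_add_distrib]
  -- (a) the average piece: `Σ_x Σ_z K3_{yzx} = Σ_z Σ_x K3_{yzx} ≤ k3r`
  have ha : ∑ x, ∑ z, K3 y z x ≤ k3r := by rw [Finset.sum_comm]; exact hk3r y
  -- (b) `Σ_x Σ_z E(g_{xz}, b_y) = Σ_{(x,z)} E(b_y, g_{xz})`
  have hb : ∑ x, ∑ z, ∑ w, (∑ z', D z' w * g x z z') * (∑ z', D z' w * b y z') / c ≤ br * (gc * dr * dc / c) := by
    have e : ∀ x z, ∑ w, (∑ z', D z' w * g x z z') * (∑ z', D z' w * b y z') / c = ∑ w, (∑ z', D z' w * b y z') * (∑ z', D z' w * g x z z') / c :=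
      fun x z => two_point_symm _ _ D c
    simp_rw [e]
    calc ∑ x, ∑ z, ∑ w, (∑ z', D z' w * b y z') * (∑ z', D z' w * g x z z') / c ≤ (∑ z', b y z') * gc * dr * dc / c :=
          two_point_pair_sum_le hD hDr hDc hc (fun z' => hb0 y z') hg0 hgc
      _ = (∑ z', b y z') * (gc * dr * dc / c) := by ring
      _ ≤ br * (gc * dr * dc / c) := mul_le_mul_of_nonneg_right (hbr y) hK'
  -- (c) `Σ_x Σ_z E(g_{xy}, b_z)`: per `x` a family sum, then the second-index mass `gm`
  have hc' : ∑ x, ∑ z, ∑ w, (∑ z', D z' w * g x y z') * (∑ z', D z' w * b z z') / c ≤ gm * (bc * dr * dc / c) := by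
    calc ∑ x, ∑ z, ∑ w, (∑ z', D z' w * g x y z') * (∑ z', D z' w * b z z') / c ≤ ∑ x, (∑ z', g x y z') * bc * dr * dc / c :=
          Finset.sum_le_sum fun x _ => two_point_family_sum_le hD hDr hDc hc (fun z' => hg0 x y z') hb0 hbc
      _ = (∑ x, ∑ z', g x y z') * (bc * dr * dc / c) := by rw [Finset.sum_mul]; exact Finset.sum_congr rfl fun x _ => by ring
      _ ≤ gm * (bc * dr * dc / c) := mul_le_mul_of_nonneg_right (hgm y) hK
  -- (d) `Σ_x Σ_z E(b_x, g_{yz}) = Σ_z Σ_x E(g_{yz}, b_x)`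
  have hd : ∑ x, ∑ z, ∑ w, (∑ z', D z' w * b x z') * (∑ z', D z' w * g y z z') / c ≤ gr * (bc * dr * dc / c) := by
    have e : ∀ x z, ∑ w, (∑ z', D z' w * b x z') * (∑ z', D z' w * g y z z') / c = ∑ w, (∑ z', D z' w * g y z z') * (∑ z', D z' w * b x z') / c :=
      fun x z => two_point_symm _ _ D c
    simp_rw [e]
    rw [Finset.sum_comm]
    calc ∑ z, ∑ x, ∑ w, (∑ z', D z' w * g y z z') * (∑ z', D z' w * b x z') / c ≤ ∑ z, (∑ z', g y z z') * bc * dr * dc / c :=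
          Finset.sum_le_sum fun z _ => two_point_family_sum_le hD hDr hDc hc (fun z' => hg0 y z z') hb0 hbc
      _ = (∑ z, ∑ z', g y z z') * (bc * dr * dc / c) := by rw [Finset.sum_mul]; exact Finset.sum_congr rfl fun z _ => by ring
      _ ≤ gr * (bc * dr * dc / c) := mul_le_mul_of_nonneg_right (hgr y) hK
  -- (e) the tree piece
  have he : ∑ x, ∑ z, CT / (ρ x y * ρ x z) ≤ CT * S ^ 2 := tree_sum_slot_two hCT hρ1 hρsymm hS y
  have etot : k3r + (br * gc + gm * bc + gr * bc) * dr * dc / c + CT * S ^ 2 =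
      k3r + br * (gc * dr * dc / c) + gm * (bc * dr * dc / c) + gr * (bc * dr * dc / c) + CT * S ^ 2 := by ring
  rw [etot]
  linarith

/-- **SLOT 3 (`z` fixed)**: `Σ_x Σ_y M_{xyz} ≤ k3m + (2·gm·bc + br·gc)·dr·dc∕c + C_T·S²`. [folklore] -/
theorem entry_majorant_slot_three [Nonempty κ] (hD : ∀ x y, 0 ≤ D x y) (hDr : ∀ z, ∑ w, D z w ≤ dr) (hDc : ∀ w, ∑ z, D z w ≤ dc) (hc : 0 < c)
    (hg0 : ∀ x y w, 0 ≤ g x y w) (hb0 : ∀ v w, 0 ≤ b v w) (hgm : ∀ y, ∑ x, ∑ w, g x y w ≤ gm) (hgc : ∀ w, ∑ y, ∑ z, g y z w ≤ gc)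
    (hbr : ∀ v, ∑ w, b v w ≤ br) (hbc : ∀ w, ∑ v, b v w ≤ bc) (hk3m : ∀ y, ∑ x, ∑ u, K3 x y u ≤ k3m)
    (hCT : 0 ≤ CT) (hρ1 : ∀ x y, 1 ≤ ρ x y) (hρsymm : ∀ x y, ρ x y = ρ y x) (hS : ∀ x, ∑ y, 1 / ρ x y ≤ S) (z : ι) :
    ∑ x, ∑ y, (K3 y z x + ∑ w, (∑ z', D z' w * g x z z') * (∑ z', D z' w * b y z') / c + ∑ w, (∑ z', D z' w * g x y z') * (∑ z', D z' w * b z z') / c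
        +
        ∑ w, (∑ z', D z' w * b x z') * (∑ z', D z' w * g y z z') / c + CT / (ρ x y * ρ x z)) ≤
      k3m + (2 * (gm * bc) + br * gc) * dr * dc / c + CT * S ^ 2 := by
  obtain ⟨w₀⟩ := ‹Nonempty κ›
  have hbc0 : 0 ≤ bc := le_trans (Finset.sum_nonneg fun v _ => hb0 v w₀) (hbc w₀)
  have hgc0 : 0 ≤ gc := le_trans (Finset.sum_nonneg fun y _ => Finset.sum_nonneg fun z _ => hg0 y z w₀) (hgc w₀)
  have hdr0 : 0 ≤ dr := le_trans (Finset.sum_nonneg fun w _ => hD w₀ w) (hDr w₀)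
  have hdc0 : 0 ≤ dc := le_trans (Finset.sum_nonneg fun z _ => hD z w₀) (hDc w₀)
  have hK : 0 ≤ bc * dr * dc / c := by positivity
  have hK' : 0 ≤ gc * dr * dc / c := by positivity
  simp only [Finset.sum_add_distrib]
  -- (a) the average piece: `Σ_x Σ_y K3_{yzx} = Σ_y Σ_x K3_{yzx} ≤ k3m` (second index `z` fixed)
  have ha : ∑ x, ∑ y, K3 y z x ≤ k3m := by rw [Finset.sum_comm]; exact hk3m z
  -- (b) `Σ_x Σ_y E(g_{xz}, b_y)`: per `x` a family sum, then the second-index mass at `z`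
  have hb : ∑ x, ∑ y, ∑ w, (∑ z', D z' w * g x z z') * (∑ z', D z' w * b y z') / c ≤ gm * (bc * dr * dc / c) := by
    calc ∑ x, ∑ y, ∑ w, (∑ z', D z' w * g x z z') * (∑ z', D z' w * b y z') / c ≤ ∑ x, (∑ z', g x z z') * bc * dr * dc / c :=
          Finset.sum_le_sum fun x _ => two_point_family_sum_le hD hDr hDc hc (fun z' => hg0 x z z') hb0 hbc
      _ = (∑ x, ∑ z', g x z z') * (bc * dr * dc / c) := by rw [Finset.sum_mul]; exact Finset.sum_congr rfl fun x _ => by ring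
      _ ≤ gm * (bc * dr * dc / c) := mul_le_mul_of_nonneg_right (hgm z) hK
  -- (c) `Σ_x Σ_y E(g_{xy}, b_z) = Σ_{(x,y)} E(b_z, g_{xy})`
  have hc' : ∑ x, ∑ y, ∑ w, (∑ z', D z' w * g x y z') * (∑ z', D z' w * b z z') / c ≤ br * (gc * dr * dc / c) := by
    have e : ∀ x y, ∑ w, (∑ z', D z' w * g x y z') * (∑ z', D z' w * b z z') / c = ∑ w, (∑ z', D z' w * b z z') * (∑ z', D z' w * g x y z') / c :=
      fun x y => two_point_symm _ _ D c
    simp_rw [e]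
    calc ∑ x, ∑ y, ∑ w, (∑ z', D z' w * b z z') * (∑ z', D z' w * g x y z') / c ≤ (∑ z', b z z') * gc * dr * dc / c :=
          two_point_pair_sum_le hD hDr hDc hc (fun z' => hb0 z z') hg0 hgc
      _ = (∑ z', b z z') * (gc * dr * dc / c) := by ring
      _ ≤ br * (gc * dr * dc / c) := mul_le_mul_of_nonneg_right (hbr z) hK'
  -- (d) `Σ_x Σ_y E(b_x, g_{yz}) = Σ_y Σ_x E(g_{yz}, b_x)`
  have hd : ∑ x, ∑ y, ∑ w, (∑ z', D z' w * b x z') * (∑ z', D z' w * g y z z') / c ≤ gm * (bc * dr * dc / c) := by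
    have e : ∀ x y, ∑ w, (∑ z', D z' w * b x z') * (∑ z', D z' w * g y z z') / c = ∑ w, (∑ z', D z' w * g y z z') * (∑ z', D z' w * b x z') / c :=
      fun x y => two_point_symm _ _ D c
    simp_rw [e]
    rw [Finset.sum_comm]
    calc ∑ y, ∑ x, ∑ w, (∑ z', D z' w * g y z z') * (∑ z', D z' w * b x z') / c ≤ ∑ y, (∑ z', g y z z') * bc * dr * dc / c :=
          Finset.sum_le_sum fun y _ => two_point_family_sum_le hD hDr hDc hc (fun z' => hg0 y z z') hb0 hbc
      _ = (∑ y, ∑ z', g y z z') * (bc * dr * dc / c) := by rw [Finset.sum_mul]; exact Finset.sum_congr rfl fun y _ => by ring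
      _ ≤ gm * (bc * dr * dc / c) := mul_le_mul_of_nonneg_right (hgm z) hK
  -- (e) the tree piece
  have he : ∑ x, ∑ y, CT / (ρ x y * ρ x z) ≤ CT * S ^ 2 := tree_sum_slot_three hCT hρ1 hρsymm hS z
  have etot : k3m + (2 * (gm * bc) + br * gc) * dr * dc / c + CT * S ^ 2 =
      k3m + gm * (bc * dr * dc / c) + br * (gc * dr * dc / c) + gm * (bc * dr * dc / c) + CT * S ^ 2 := by ring
  rw [etot]
  linarith

/-! ## §3. Toy -/

/-- Toy (§1's symmetry in numbers): `(1·2)(1·3)∕1 = (1·3)(1·2)∕1`. -/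
example : ((1 : ℝ) * 2) * (1 * 3) / 1 = (1 * 3) * (1 * 2) / 1 := by norm_num

end Summit.QuantumFields.BalabanUV.T4Continuum.NE7b.SupThirdKernelEntryLetters

end
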